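import Summits.ValiantsHypothesis.ValiantsHypothesis.Theorems.SymPencilPerFourCrossPairNoJoint

/-!
# Route `SymPencil` — the block element `E₀₂ + E₁₀ + E₁₁ + E₂₀ − E₂₁` has Hessian rank `6`:
# no per-direction family of `< 6` squares on a subspace containing it
# (`--supports` stmt-ValiantsHypothesis-5674 `SdcSuperquadratic`; the "block/ruling" branch of
# Case B3 at dimension `5`, size-`27` cell `(11, 5, 4)`)

In Case B3 at dimension `5` (`SymPencilPerFourZeroCellStructure`) the row-kernel `W₀` is a
`2`-dimensional perm-isotropic plane, hence (`SymPencilPerFourPermIsotropicPlanes`) a row plane, a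
column plane, or a plane inside a `2 × 2` block; in the last case `W₀` is one of the two rulings
`span {E_{bj} + λE_{cj}, E_{bl} − λE_{cl}}`, `span {E_{bj} + κE_{bl}, E_{cj} − κE_{cl}}` of the block,
and after the torus / permutation normalisation (`SymPencilPerFourJointFamilyTransport`) the
product space `(row a) ⊕ W₀` contains the matrix

  `y₀ = E₀₂ + E₁₀ + E₁₁ + E₂₀ − E₂₁`   (row `0 = e₂`, block `[[1, 1], [1, −1]]` on rows `1,2` × columns `0,1`).

**Theorem** (`not_sqFamilySwap_blockElem`).  Over a field of characteristic `0` there are no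
`c : ι → K`, `Λ : ι → (K^{4×4})^*` with `|ι| < 6` and
`per_4 (u + s y₀) = e₀ + s e₁ + s² Σ_k c_k Λ_k(u)²` for all `u`: the `s²`-coefficient
`Q(u) = u₃₃ (u₂₀ + u₂₁ + u₁₁ − u₁₀) + u₂₃ (u₃₀ + u₃₁) + u₁₃ (u₃₁ − u₃₀)` has rank `6` (a common-kernel
vector of the `Λ_k` on the six test cells `(1,0), (1,3), (2,3), (3,0), (3,1), (3,3)` would be
`Q`-orthogonal to them, forcing it to vanish).  **Corollary** (`not_sqFamilySwap_of_mem_blockElem`):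
no subspace containing `y₀` carries a per-direction family of `< 6` squares — so the block/ruling
branch of Case B3 dies already by per-direction counting (at `d = 4` and `d = 5`).

Honest framing: a brick; `27 ≤ sdc(per₄) ≤ 29` unchanged, the crux `SdcSuperquadratic` and
`VP ≠ VNP` untouched.  No definitions, no named facts. [folklore]
-/

noncomputable section

-- single-conjunct layout: Sub = Summit, duplicated namespace component intended
set_option linter.dupNamespace false

namespace Summit.ValiantsHypothesis.ValiantsHypothesis.Theorems.SymPencilPerFourBlockElemRankSix

open MvPolynomial Module Matrix
open Literature.Computability.AlgebraicComplexity
open Summit.ValiantsHypothesis.ValiantsHypothesis.Theorems.SymPencilBoxFourEquality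
open Summit.ValiantsHypothesis.ValiantsHypothesis.Theorems.SymPencilPerFourCrossPairNoJoint

variable {K : Type*} [Field K]

/-- **The block element has Hessian rank `6`.**  See the module docstring. [folklore] -/
theorem not_sqFamilySwap_blockElem [CharZero K] {ι : Type*} [Fintype ι]
    (hι : Fintype.card ι < 6) (c : ι → K) (Λ : ι → ((Fin 4 × Fin 4 → K) →ₗ[K] K)) :
    ¬ (∀ u : Fin 4 × Fin 4 → K, ∃ e₀ e₁ : K, ∀ s : K,
        eval (u + s • (fun p : Fin 4 × Fin 4 =>
          if p = (0, 2) then (1 : K) else if p = (1, 0) then 1 else if p = (1, 1) then 1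
          else if p = (2, 0) then 1 else if p = (2, 1) then -1 else 0)) (perPoly (Fin 4) K) =
          e₀ + s * e₁ + s ^ 2 * ∑ k, c k * (Λ k u) ^ 2) := by
  classical
  intro hfam
  set y₀ : Fin 4 × Fin 4 → K := fun p =>
    if p = (0, 2) then (1 : K) else if p = (1, 0) then 1 else if p = (1, 1) then 1
    else if p = (2, 0) then 1 else if p = (2, 1) then -1 else 0 with hy₀
  -- Fin 4 literal facts and `succAbove`
  obtain ⟨f01, f02, f03, f10, f12, f13, f20, f21, f23, f30, f31, f32⟩ :
      (((0 : Fin 4) = 1) = False) ∧ (((0 : Fin 4) = 2) = False) ∧ (((0 : Fin 4) = 3) = False) ∧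
      (((1 : Fin 4) = 0) = False) ∧ (((1 : Fin 4) = 2) = False) ∧ (((1 : Fin 4) = 3) = False) ∧
      (((2 : Fin 4) = 0) = False) ∧ (((2 : Fin 4) = 1) = False) ∧ (((2 : Fin 4) = 3) = False) ∧
      (((3 : Fin 4) = 0) = False) ∧ (((3 : Fin 4) = 1) = False) ∧ (((3 : Fin 4) = 2) = False) := by
    refine ⟨?_, ?_, ?_, ?_, ?_, ?_, ?_, ?_, ?_, ?_, ?_, ?_⟩ <;> decide
  obtain ⟨e00, e01, e02, e10, e11, e12, e20, e21, e22⟩ :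
      (0 : Fin 4).succAbove 0 = 1 ∧ (0 : Fin 4).succAbove 1 = 2 ∧ (0 : Fin 4).succAbove 2 = 3 ∧
      (1 : Fin 4).succAbove 0 = 0 ∧ (1 : Fin 4).succAbove 1 = 2 ∧ (1 : Fin 4).succAbove 2 = 3 ∧
      (2 : Fin 4).succAbove 0 = 0 ∧ (2 : Fin 4).succAbove 1 = 1 ∧ (2 : Fin 4).succAbove 2 = 3 := by
    decide
  -- (A) the `s²`-coefficient
  obtain ⟨Q, hQ⟩ : ∃ Q : (Fin 4 × Fin 4 → K) → K, ∀ u, Q u =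
      u (3, 3) * (u (2, 0) + u (2, 1) + u (1, 1) - u (1, 0)) + u (2, 3) * (u (3, 0) + u (3, 1)) +
        u (1, 3) * (u (3, 1) - u (3, 0)) := ⟨_, fun _ => rfl⟩
  have hA : ∀ (u : Fin 4 × Fin 4 → K) (s : K), eval (u + s • y₀) (perPoly (Fin 4) K) =
      (Matrix.of fun i j => u (i, j)).permanent +
      s * (((Matrix.of fun i j => u (i, j)).submatrix (0 : Fin 4).succAbove
            (2 : Fin 4).succAbove).permanent +
          ((Matrix.of fun i j => u (i, j)).submatrix (1 : Fin 4).succAbove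
            (0 : Fin 4).succAbove).permanent +
          ((Matrix.of fun i j => u (i, j)).submatrix (1 : Fin 4).succAbove
            (1 : Fin 4).succAbove).permanent +
          ((Matrix.of fun i j => u (i, j)).submatrix (2 : Fin 4).succAbove
            (0 : Fin 4).succAbove).permanent -
          ((Matrix.of fun i j => u (i, j)).submatrix (2 : Fin 4).succAbove
            (1 : Fin 4).succAbove).permanent) +
      s ^ 2 * Q u := by
    intro u s
    rw [eval_perPoly, Matrix.permanent_fin_four_row, Matrix.permanent_fin_four_row, hQ]
    simp only [Matrix.permanent_fin_three_row, Matrix.of_apply, Matrix.submatrix_apply, Pi.add_apply,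
      Pi.smul_apply, smul_eq_mul, hy₀, Prod.mk.injEq, e00, e01, e02, e10, e11, e12, e20, e21,
      e22, f01, f02, f10, f12, f20, f21, f30, f31, f32, and_true, and_false, if_true, if_false]
    ring
  -- (B) coefficient extraction
  have hB : ∀ u : Fin 4 × Fin 4 → K, ∑ k, c k * (Λ k u) ^ 2 = Q u := by
    intro u
    obtain ⟨e₀, e₁, he⟩ := hfam u
    exact coeff_two_eq_of_forall₂ (fun s => (he s).symm.trans (hA u s))
  -- (C) the six test cells as a linear parametrisation and a common-kernel vector
  let U : (Fin 6 → K) →ₗ[K] (Fin 4 × Fin 4 → K) :=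
    { toFun := fun n p => if p = (1, 0) then n 0 else if p = (1, 3) then n 1
        else if p = (2, 3) then n 2 else if p = (3, 0) then n 3
        else if p = (3, 1) then n 4 else if p = (3, 3) then n 5 else 0
      map_add' := fun a b => by
        ext p
        simp only [Pi.add_apply]
        split_ifs <;> simp
      map_smul' := fun a n => by
        ext p
        simp only [Pi.smul_apply, smul_eq_mul, RingHom.id_apply]
        split_ifs <;> simp }
  have hU : ∀ (n : Fin 6 → K) (p : Fin 4 × Fin 4), U n p = (if p = (1, 0) then n 0
      else if p = (1, 3) then n 1 else if p = (2, 3) then n 2 else if p = (3, 0) then n 3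
      else if p = (3, 1) then n 4 else if p = (3, 3) then n 5 else 0) := fun _ _ => rfl
  let M : (Fin 6 → K) →ₗ[K] (ι → K) := LinearMap.pi fun k => (Λ k).comp U
  have hM : ∀ n k, M n k = Λ k (U n) := fun n k => rfl
  have hker : LinearMap.ker M ≠ ⊥ := LinearMap.ker_ne_bot_of_finrank_lt (by
    rw [Module.finrank_fintype_fun_eq_card, Module.finrank_fintype_fun_eq_card, Fintype.card_fin]
    omega)
  obtain ⟨n, hn, hn0⟩ := Submodule.exists_mem_ne_zero_of_ne_bot hker
  have hΛ0 : ∀ k, Λ k (U n) = 0 := fun k => by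
    have := congr_fun (LinearMap.mem_ker.1 hn) k
    rwa [hM] at this
  -- (D) `Q (U n + e) = Q e` for every `e`, and `Q (U n) = 0`
  have hQn : Q (U n) = 0 := by
    rw [← hB (U n)]
    exact Finset.sum_eq_zero fun k _ => by rw [hΛ0 k]; ring
  have hQadd : ∀ e : Fin 4 × Fin 4 → K, Q (U n + e) = Q e := by
    intro e
    rw [← hB (U n + e), ← hB e]
    exact Finset.sum_congr rfl fun k _ => by rw [map_add, hΛ0 k, zero_add]
  -- the unit matrices
  obtain ⟨E, hE⟩ : ∃ E : Fin 4 × Fin 4 → (Fin 4 × Fin 4 → K), ∀ P p, E P p = if p = P then 1 else 0 :=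
    ⟨fun P p => if p = P then 1 else 0, fun _ _ => rfl⟩
  -- the six relations `2 Φ(U n, e) = 0`
  have r33 := hQadd (E (3, 3))
  have r10 := hQadd (E (1, 0))
  have r13 := hQadd (E (1, 3))
  have r23 := hQadd (E (2, 3))
  have r30 := hQadd (E (3, 0))
  have r31 := hQadd (E (3, 1))
  simp only [hQ, hU, hE, Pi.add_apply, Prod.mk.injEq, f01, f03, f10, f12, f13, f21, f23, f30,
    f31, f32, and_true, and_false, if_true, if_false] at r33 r10 r13 r23 r30 r31 hQn
  have h0 : n 0 = 0 := by linear_combination -r33 + hQn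
  have h5 : n 5 = 0 := by linear_combination -r10 + hQn
  have h3 : n 3 = 0 := by linear_combination (-(r13 - hQn) + (r23 - hQn)) / 2
  have h4 : n 4 = 0 := by linear_combination ((r13 - hQn) + (r23 - hQn)) / 2
  have h1 : n 1 = 0 := by linear_combination (-(r30 - hQn) + (r31 - hQn)) / 2
  have h2 : n 2 = 0 := by linear_combination ((r30 - hQn) + (r31 - hQn)) / 2
  apply hn0
  funext i
  fin_cases i
  · exact h0
  · exact h1
  · exact h2
  · exact h3
  · exact h4
  · exact h5

/-- **No per-direction family of `< 6` squares on a subspace containing the block element.**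
[folklore] -/
theorem not_sqFamilySwap_of_mem_blockElem [CharZero K] {ι : Type*} [Fintype ι]
    (hι : Fintype.card ι < 6) (W : Submodule K (Fin 4 × Fin 4 → K))
    (hmem : (fun p : Fin 4 × Fin 4 =>
      if p = (0, 2) then (1 : K) else if p = (1, 0) then 1 else if p = (1, 1) then 1
      else if p = (2, 0) then 1 else if p = (2, 1) then -1 else 0) ∈ W) :
    ¬ (∀ y ∈ W, ∃ (c : ι → K) (Λ : ι → ((Fin 4 × Fin 4 → K) →ₗ[K] K)),
        ∀ u : Fin 4 × Fin 4 → K, ∃ e₀ e₁ : K, ∀ s : K,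
          eval (u + s • y) (perPoly (Fin 4) K) = e₀ + s * e₁ + s ^ 2 * ∑ k, c k * (Λ k u) ^ 2) := by
  intro hW
  obtain ⟨c, Λ, h⟩ := hW _ hmem
  exact not_sqFamilySwap_blockElem hι c Λ h

end Summit.ValiantsHypothesis.ValiantsHypothesis.Theorems.SymPencilPerFourBlockElemRankSix

end
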